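import Literature.NumberTheory.Transcendental.NesterenkoElimination
import Mathlib.Analysis.SpecialFunctions.Pow.Real
import HarnessLib

/-!
# Nesterenko's diophantine estimates for homogeneous polynomial ideals (LNM 1752 Ch. 3 §4, `K = ℚ`) — named facts

Topic `Literature/NumberTheory/Transcendental`. The PROPOSITIONS of Nesterenko's "algebraic
fundamentals" (Nesterenko–Philippon (eds.), LNM 1752 (2001), Ch. 3 §4, pp. 38–42, quoted there from
[Nes10] §1), for the objects defined in `NesterenkoElimination.lean` and in the case used by Ch. 3
§5: `K = ℚ`, `ν = 1`, the ordinary absolute value, `𝒦 = ℂ`. Each is vendored as a NAMED FACT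
(`def … : Prop`, nothing asserted); users take `(h : …)`. They are the trust base of the proof of
Ch. 3 Theorem 5.1 and hence of the second proof of Theorem 1.1
(`Literature.Barriers.Schanuel.nesterenko1996_thm_1_1`) in
`Literature/Barriers/Schanuel/NesterenkoModularScopeMeasure*.lean`.

* `NesterenkoPhilippon2001_ch3_prop_4_4` — Proposition 4.4 (`Ī(r)` is principal, generated by
  `∏ F_j^{k_j}`, `F_j` irreducible generators of `p̄_j(r)`) together with the remark following it
  (`F` is symmetric in `u₁, …, u_r`, whence all its partial degrees `deg_{uᵢ} F` agree).
* `NesterenkoPhilippon2001_ch3_prop_4_7` — Proposition 4.7 (degree, height and value of an unmixed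
  ideal versus those of its associated primes).
* `NesterenkoPhilippon2001_ch3_cor_4_9` — Corollary 4.9 (`‖A‖_ω̄ ≤ ρ e^{(2m+1) deg A}` for `A ∈ 𝔭`).
* `NesterenkoPhilippon2001_ch3_cor_4_10` — Corollary 4.10 ((21): `|𝔭(ω̄)| ≤ ρ e^{5m² deg 𝔭}`).
* `NesterenkoPhilippon2001_ch3_cor_4_12` — Corollary 4.12 (intersecting `V(𝔭)` with a hypersurface
  `P = 0` that is small at `ω̄`), including its last sentence (the case `dim 𝔭 = 0`), for `P` of
  degree `deg P ≥ 1`: the printed wording ("`P ≠ 0` homogeneous, `P ∉ 𝔭`") also lets in the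
  non-zero constants, for which the statement is false (counterexample in the docstring), so the
  fact carries `1 ≤ d` explicitly — see "Degenerate cases" below.
* `NesterenkoPhilippon2001_ch3_prop_4_13` — Proposition 4.13 (a zero of `I` close to `ω̄`).

## Conventions of the encoding

* `dim I = r − 1` (projective) is `IsUnmixedOfRank I r`; "`dim 𝔭 ≥ 0`" is `1 ≤ r`; the variables
  `u₁, …, u_r` of Definition 4.3 exist for `1 ≤ r ≤ m`, so every fact carries `1 ≤ r ≤ m`.
* The printed inequalities involve `log |I(ω̄)|`, `log ‖P‖_ω̄`, `log (1/ρ)` for quantities that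
  may vanish (e.g. `ρ(ω̄) = 0` when `ω̄ ∈ V(𝔭)`, `|𝔭(ω̄)| = 0` when `ω̄ ∈ V(𝔭)` by Corollary 4.10),
  read in print with `log 0 = −∞`. Since Lean's `Real.log 0 = 0`, every such inequality is vendored
  in the equivalent EXPONENTIATED (multiplicative) form, which is literally faithful to that reading:
  e.g. Prop. 4.7 3) `∑ k_j log |𝔭_j(ω̄)| ≤ log |I(ω̄)| + m³ deg I` becomes
  `∏ |𝔭_j(ω̄)|^{k_j} ≤ |I(ω̄)| e^{m³ deg I}`, and the hypothesis
  `−η log ‖P‖_ω̄ ≥ 2 min(S, log (1/ρ))` of Cor. 4.12 becomes `‖P‖_ω̄^η ≤ max(e^{−S}, ρ)²`.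
* Points `ω̄ ∈ 𝒦^{m+1}` are taken non-zero (they are points of `P^m`; Prop. 4.7 says so explicitly).
* `deg` of a homogeneous polynomial `P ≠ 0` of degree `d` is `d` (= `P.totalDegree`); `h(P)` is
  `Nesterenko.height P` (Definition 4.2), `H`-free.

## Degenerate cases

* Corollary 4.12 (and likewise the last sentence of Proposition 4.11) is printed for "`P ≠ 0`
  homogeneous, `P ∉ 𝔭`", which formally includes the constants `P = c ≠ 0` (`deg P = 0`,
  `‖P‖_ω̄ = 1`, `h(P) = 0`). In that case the hypotheses reduce to `|𝔭(ω̄)| ≤ e^{−S} < 1` and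
  `ρ(ω̄) ≥ 1`, and for `dim 𝔭 = 0` the conclusion reads `0 ≤ −S`: the printed statement is false
  there. Instance: `m = 1`, `𝔭 = (2x₁² + 3x₀x₁ + 2x₀²) ⊂ ℚ[x₀, x₁]` (prime, homogeneous,
  `dim 𝔭 = 0`), `ω̄ = (0, 1)`: the zeros of `𝔭` are `(1 : t)` with `2t² + 3t + 2 = 0`, `|t| = 1`,
  so `ρ(ω̄) = min |0·t − 1·1| / (|ω̄| max(1, |t|)) = 1`; the associated form is
  `F = ±(2u₁₀² − 3u₁₀u₁₁ + 2u₁₁²)` (`= P(Δ₀, Δ₁)`, `Δ = (u₁₁, −u₁₀)`), `ϰ(F) = 2 s₀₁²`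
  (`u₁₀ ↦ s₀₁ ω₁ = s₀₁`, `u₁₁ ↦ s₁₀ ω₀ = 0`), whence `|𝔭(ω̄)| = 2 · 3⁻¹ · 1 = 2/3`; with `P = 1`,
  `η = 1`, `S = log (3/2)` all hypotheses hold and the conclusion `1 ≤ e^{−S} = 2/3` fails. Every
  use of the Corollary (Ch. 3 §5 applies it to `E` of degree `n ≥ 1`; [Nes10] Cor. 3) and its
  proof (Proposition 4.11 applied to `Q = P^η`, [Nes10, Cor. 3]) have `deg P ≥ 1`, so the fact is
  vendored with the hypothesis `1 ≤ d` (the earlier `d`-unrestricted encoding was refutable by the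
  instance above and was restated; its one application, Ch. 3 §5, supplies `n ≥ 1`).

## References

* [NesterenkoPhilippon2001] LNM 1752 (2001), Ch. 3 (Yu. V. Nesterenko) §4: Prop. 4.4 (p. 38),
  Prop. 4.7 (p. 39), Cor. 4.9, Cor. 4.10 with (21) (p. 40), Cor. 4.12, Prop. 4.13 (p. 41);
  PDF page = book page + 12.
* [Nes10] Yu. V. Nesterenko, Proc. Steklov Inst. Math. 218 (1997) 294–331, Prop. 1.2–1.5,
  Cor. 1–3 (the proofs referred to in §4).
-/

noncomputable section

open MvPolynomial

attribute [local instance] MvPolynomial.gradedAlgebra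

namespace Literature.NumberTheory.Transcendental

namespace Nesterenko

/-- **LNM 1752 Ch. 3 Proposition 4.4** (with the remark following it). Let `I ⊂ ℚ[x₀, …, x_m]` be a
homogeneous unmixed ideal with `dim I = r − 1` (`1 ≤ r ≤ m`), `I = I₁ ∩ … ∩ I_s` its reduced primary
decomposition, `𝔭_j = √I_j`, `k_j` the exponent of `I_j`. Then `Ī(r)` is a principal ideal of
`ℚ[U]`, and if `p̄_j(r) = (F_j)` then the `F_j` are irreducible and `F = F₁^{k₁} ⋯ F_s^{k_s}`
generates `Ī(r)`; moreover the associated form is symmetric in `u₁, …, u_r` (and homogeneous), so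
that its degrees in the groups of variables `uᵢ` all equal `deg I = deg_{u₁} F`. Users take
`(h : NesterenkoPhilippon2001_ch3_prop_4_4)`.
[cite: NesterenkoPhilippon2001, Ch. 3 Prop. 4.4 and the following paragraph (p. 38)] -/
def NesterenkoPhilippon2001_ch3_prop_4_4 : Prop :=
  ∀ (m r : ℕ) (I : Ideal (Rx m)), 1 ≤ r → r ≤ m →
    I.IsHomogeneous (homogeneousSubmodule (Fin (m + 1)) ℚ) → IsUnmixedOfRank I r →
    ∀ t : Finset (Ideal (Rx m)), Submodule.IsMinimalPrimaryDecomposition I t →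
      (elimIdeal I r).IsPrincipal ∧
      (∀ Q ∈ t, (elimIdeal Q.radical r).IsPrincipal) ∧
      (∀ F : Ideal (Rx m) → RU r m, (∀ Q ∈ t, Ideal.span {F Q} = elimIdeal Q.radical r) →
        (∀ Q ∈ t, Irreducible (F Q)) ∧
        Ideal.span {∏ Q ∈ t, F Q ^ primaryExponent Q} = elimIdeal I r) ∧
      (∀ i : Fin r, blockDeg (chowForm I r) i = ideg I r)

/-- **LNM 1752 Ch. 3 Proposition 4.7** (`K = ℚ`, `ν = 1`). Let `I` be an unmixed homogeneous ideal
of `ℚ[x₀, …, x_m]` with `dim I = r − 1 ≥ 0`, `I = I₁ ∩ … ∩ I_s` its reduced primary decomposition,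
`𝔭_j = √I_j`, `k_j` the exponent of `I_j`, and `ω̄ ∈ ℂ^{m+1} ∖ 0`. Then
1) `∑ k_j deg 𝔭_j = deg I`; 2) `∑ k_j h(𝔭_j) ≤ h(I) + m² deg I`;
3) `∑ k_j log |𝔭_j(ω̄)| ≤ log |I(ω̄)| + m³ deg I` (exponentiated form). Users take
`(h : NesterenkoPhilippon2001_ch3_prop_4_7)`.
[cite: NesterenkoPhilippon2001, Ch. 3 Prop. 4.7 (p. 39)] -/
def NesterenkoPhilippon2001_ch3_prop_4_7 : Prop :=
  ∀ (m r : ℕ) (I : Ideal (Rx m)), 1 ≤ r → r ≤ m →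
    I.IsHomogeneous (homogeneousSubmodule (Fin (m + 1)) ℚ) → IsUnmixedOfRank I r →
    ∀ t : Finset (Ideal (Rx m)), Submodule.IsMinimalPrimaryDecomposition I t →
    ∀ ω : Fin (m + 1) → ℂ, ω ≠ 0 →
      (∑ Q ∈ t, primaryExponent Q * ideg Q.radical r = ideg I r) ∧
      (∑ Q ∈ t, (primaryExponent Q : ℝ) * iheight Q.radical r ≤
          iheight I r + (m : ℝ) ^ 2 * ideg I r) ∧
      (∏ Q ∈ t, iabs Q.radical r ω ^ primaryExponent Q ≤
          iabs I r ω * Real.exp ((m : ℝ) ^ 3 * ideg I r))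

/-- **LNM 1752 Ch. 3 Corollary 4.9** (archimedean case). Let `𝔭 ⊂ ℚ[x₀, …, x_m]` be a homogeneous
prime ideal with `dim 𝔭 = r − 1 ≥ 0`, `ω̄ ∈ ℂ^{m+1} ∖ 0`, `ρ = ρ(ω̄)` the distance (20) from `ω̄` to
`V(𝔭)`. If `A ∈ 𝔭` is homogeneous (of degree `deg A`), then `‖A‖_ω̄ ≤ ρ · e^{(2m+1) deg A}`. Users
take `(h : NesterenkoPhilippon2001_ch3_cor_4_9)`.
[cite: NesterenkoPhilippon2001, Ch. 3 Cor. 4.9 (p. 40)] -/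
def NesterenkoPhilippon2001_ch3_cor_4_9 : Prop :=
  ∀ (m r : ℕ) (𝔭 : Ideal (Rx m)), 1 ≤ r → r ≤ m → 𝔭.IsPrime →
    𝔭.IsHomogeneous (homogeneousSubmodule (Fin (m + 1)) ℚ) → IsUnmixedOfRank 𝔭 r →
    ∀ (A : Rx m) (d : ℕ), A ∈ 𝔭 → A.IsHomogeneous d →
    ∀ ω : Fin (m + 1) → ℂ, ω ≠ 0 →
      normAt ω A ≤ rho ω 𝔭 * Real.exp ((2 * m + 1 : ℝ) * d)

/-- **LNM 1752 Ch. 3 Corollary 4.10, (21)** (archimedean case). For a homogeneous prime ideal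
`𝔭 ⊂ ℚ[x₀, …, x_m]` with `dim 𝔭 = r − 1 ≥ 0` and `ω̄ ∈ ℂ^{m+1} ∖ 0`: `|𝔭(ω̄)| ≤ ρ e^{5m² deg 𝔭}`,
`ρ = ρ(ω̄)` the distance (20) from `ω̄` to `V(𝔭)`. Users take
`(h : NesterenkoPhilippon2001_ch3_cor_4_10)`.
[cite: NesterenkoPhilippon2001, Ch. 3 Cor. 4.10, (21) (p. 40)] -/
def NesterenkoPhilippon2001_ch3_cor_4_10 : Prop :=
  ∀ (m r : ℕ) (𝔭 : Ideal (Rx m)), 1 ≤ r → r ≤ m → 𝔭.IsPrime →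
    𝔭.IsHomogeneous (homogeneousSubmodule (Fin (m + 1)) ℚ) → IsUnmixedOfRank 𝔭 r →
    ∀ ω : Fin (m + 1) → ℂ, ω ≠ 0 →
      iabs 𝔭 r ω ≤ rho ω 𝔭 * Real.exp (5 * (m : ℝ) ^ 2 * ideg 𝔭 r)

/-- **LNM 1752 Ch. 3 Corollary 4.12** (`K = ℚ`, `ν = 1`). Let `P ∈ ℚ[x₀, …, x_m]`, `P ≠ 0`, be
homogeneous of degree `deg P = d ≥ 1` (on `d ≥ 1` see below), `𝔭` a homogeneous prime ideal with
`dim 𝔭 = r − 1 ≥ 0`, `P ∉ 𝔭`, `ω̄ ∈ ℂ^{m+1} ∖ 0`, `ρ = ρ(ω̄)` the distance from `ω̄` to `V(𝔭)`.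
Suppose `|𝔭(ω̄)| ≤ e^{−S}` (`S > 0`), `‖P‖_ω̄ ≤ e^{−2m deg P}`, and, for an integer `η > 0`,
`−η log ‖P‖_ω̄ ≥ 2 min(S, log (1/ρ))` (i.e. `‖P‖_ω̄^η ≤ max(e^{−S}, ρ)²`). If `dim 𝔭 ≥ 1` there is a
homogeneous unmixed ideal `J` with `dim J = dim 𝔭 − 1`, `V(J) = V((𝔭, P))` and
1. `deg J ≤ η deg 𝔭 deg P`; 2. `h(J) ≤ η (h(𝔭) deg P + h(P) deg 𝔭 + m(r+2) deg P deg 𝔭)`;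
3. `log |J(ω̄)| ≤ −S + η (h(𝔭) deg P + h(P) deg 𝔭 + 12 m² deg P deg 𝔭)`; and inequality 3. holds
in the case `dim 𝔭 = 0` with `|J(ω̄)|` replaced by `1`.
The hypothesis `deg P ≥ 1` (`1 ≤ d`) is implicit in print ("`P ≠ 0` homogeneous, `P ∉ 𝔭`" also
admits the non-zero constants, for which the statement fails: `m = 1`, `𝔭 = (2x₁² + 3x₀x₁ + 2x₀²)`,
`ω̄ = (0, 1)`, `P = 1`, `η = 1`, `S = log (3/2)` give `ρ(ω̄) = 1`, `|𝔭(ω̄)| = 2/3 = e^{−S}`,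
`‖P‖_ω̄ = 1`, all hypotheses, and the false conclusion `1 ≤ e^{−S}`; see the module docstring); it
holds in every application (Ch. 3 §5: `deg E = n ≥ 1`) and in the proof ([Nes10, Cor. 3]:
Proposition 4.11 for `Q = P^η`). Users take `(h : NesterenkoPhilippon2001_ch3_cor_4_12)`.
[cite: NesterenkoPhilippon2001, Ch. 3 Cor. 4.12 (p. 41)] -/
def NesterenkoPhilippon2001_ch3_cor_4_12 : Prop :=
  ∀ (m r : ℕ) (𝔭 : Ideal (Rx m)) (P : Rx m) (d : ℕ), 1 ≤ r → r ≤ m → 𝔭.IsPrime →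
    𝔭.IsHomogeneous (homogeneousSubmodule (Fin (m + 1)) ℚ) → IsUnmixedOfRank 𝔭 r →
    P ≠ 0 → P.IsHomogeneous d → 1 ≤ d → P ∉ 𝔭 →
    ∀ (ω : Fin (m + 1) → ℂ) (S : ℝ) (η : ℕ), ω ≠ 0 → 0 < S → 0 < η →
      iabs 𝔭 r ω ≤ Real.exp (-S) →
      normAt ω P ≤ Real.exp (-(2 * (m : ℝ) * d)) →
      normAt ω P ^ η ≤ max (Real.exp (-S)) (rho ω 𝔭) ^ 2 →
      (2 ≤ r → ∃ J : Ideal (Rx m),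
          J.IsHomogeneous (homogeneousSubmodule (Fin (m + 1)) ℚ) ∧ IsUnmixedOfRank J (r - 1) ∧
          projZeros J = projZeros (𝔭 ⊔ Ideal.span {P}) ∧
          ideg J (r - 1) ≤ η * ideg 𝔭 r * d ∧
          iheight J (r - 1) ≤ η * (iheight 𝔭 r * d + height P * ideg 𝔭 r +
            (m : ℝ) * (r + 2) * d * ideg 𝔭 r) ∧
          iabs J (r - 1) ω ≤ Real.exp (-S + η * (iheight 𝔭 r * d + height P * ideg 𝔭 r +
            12 * (m : ℝ) ^ 2 * d * ideg 𝔭 r))) ∧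
      (r = 1 → (1 : ℝ) ≤ Real.exp (-S + η * (iheight 𝔭 r * d + height P * ideg 𝔭 r +
            12 * (m : ℝ) ^ 2 * d * ideg 𝔭 r)))

/-- **LNM 1752 Ch. 3 Proposition 4.13** (`K = ℚ`, `ν = 1`). Let `I ⊂ ℚ[x₀, …, x_m]` be a
homogeneous unmixed ideal, `r = 1 + dim I ≥ 1`. Then for any `ω̄ ∈ ℂ^{m+1} ∖ 0` there is a zero
`β̄` of `I` with `deg I · log ‖ω̄ − β̄‖ ≤ (1/r) log |I(ω̄)| + (1/r) h(I) + 4 m³ deg I` (exponentiated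
form; `‖·‖` the projective distance). Users take `(h : NesterenkoPhilippon2001_ch3_prop_4_13)`.
[cite: NesterenkoPhilippon2001, Ch. 3 Prop. 4.13 (p. 41)] -/
def NesterenkoPhilippon2001_ch3_prop_4_13 : Prop :=
  ∀ (m r : ℕ) (I : Ideal (Rx m)), 1 ≤ r → r ≤ m →
    I.IsHomogeneous (homogeneousSubmodule (Fin (m + 1)) ℚ) → IsUnmixedOfRank I r →
    ∀ ω : Fin (m + 1) → ℂ, ω ≠ 0 → ∃ β ∈ projZeros I,
      projDist ω β ^ ideg I r ≤
        (iabs I r ω * Real.exp (iheight I r)) ^ (1 / (r : ℝ)) * Real.exp (4 * (m : ℝ) ^ 3 * ideg I r)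

end Nesterenko

end Literature.NumberTheory.Transcendental

end
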